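import Summits.CriticalPhenomena.PercolationContinuityZ3.Theorems.PercNearOneGluingNoHeavyRsw3InvasionEquivariance
import Summits.CriticalPhenomena.PercolationContinuityZ3.Theorems.PercNearOneGluingNoHeavyRsw3InvasionUniqueCluster
import HarnessLib

/-!
# RSW3 lane (P2, gen 30): THE STANDARD COUPLING OF `ℤ^d`, I — MERGING OF INFINITE CLUSTERS
# (Lyons–Peres 2016 Thm. 7.21 ¶2; Alexander 1995 for `ℤ^d`; Häggström–Peres–Schonmann 1999):
# **almost surely, SIMULTANEOUSLY for all levels `p_c(ℤ^d) < p₁ ≤ p₂` and all vertices `x`, every infinite `p₂`-cluster contains an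
# infinite `p₁`-cluster** (`d ≥ 2`)

builds on p205010 (kernel theorem, internal audit signed; external expert review pending) — NOT used in this file.

Cell `prim-rsw3`, prover seat `prim-rsw3-p2` (gen 30), memo `run/shared/lean/prim/rsw3/P2-RSWLITE.md` §37.  Support file
(`--supports stmt-CriticalPhenomena-4575`); no definitions, no named facts, no sorries.  `μ = labelMeasure (Site d)` (i.i.d. uniform labels
`U`), `η_p(U) = configOfLabels p U (zdGraph d) = {e : U e ≤ p}` the standard (monotone) coupling, `C_p(x) = openCluster (η_p U) x`,
`x_n(x) = acceptedLabel (zdGraph d) U x n` the `n`-th label accepted by the invasion from `x`, `I(x) = invadedRegion (zdGraph d) U x`.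

§1 (every locally finite graph, every label field, every tie-break) is the deterministic core of Lyons–Peres' proof of their Theorem 7.21
from Theorem 7.22 (book p. 364): (i) if `C_p(x)` is infinite then `I(x) ⊆ C_p(x)` (p. 360, "this is clear";
`invadedRegion_subset_openCluster_of_infinite`); (ii) if every label accepted from time `N` on is `≤ p` then — on an infinite connected
graph — some vertex of `I_N(x)` has an infinite `p`-cluster (`exists_infinite_openCluster_of_forall_acceptedLabel_le`); (iii) hence for
`p₁ ≤ p₂`: `C_{p₂}(x)` infinite and `x_n(x) ≤ p₁` eventually ⇒ `C_{p₂}(x) ⊇` an infinite `p₁`-cluster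
(`exists_infinite_subcluster_of_forall_acceptedLabel_le`).
§2 transports the tree's Chayes–Chayes–Newman Theorem 3.2 (gen 26 file IV, root `0`; = Lyons–Peres Thm. 7.22 for `ℤ^d`) to every root by
lattice translations (gen 29 file XXXVII): **a.s., for every `x ∈ ℤ^d` and every level `p > p_c`, `x_n(x) ≤ p` for all large `n`**
(`ae_forall_root_eventually_acceptedLabel_le`), whence **Lyons–Peres Thm. 7.22 in simultaneous form on `ℤ^d`: a.s. for all `p > p_c` and
all `x`, `I(x)` meets an infinite `p`-cluster** (`ae_forall_invadedRegion_meets_infinite_cluster`).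
§3 is **Lyons–Peres Thm. 7.21 ¶2 on `ℤ^d`** (`ae_merging`, `ae_merging_percolatesAt`; Alexander 1995 proved it for `ℤ^d`, Häggström–Peres 1999
/ Schonmann 1999 / Häggström–Peres–Schonmann 1999 in general).  File II (`…Rsw3CouplingSimultaneousUniqueness`) adds uniqueness at fixed levels
and p205010: simultaneous uniqueness above `p_c`, nothing at or below, for all `p` at once.

References: R. Lyons, Y. Peres, *Probability on Trees and Networks*, CUP 2016, §7.5, Thm. 7.21, Thm. 7.22, p. 364 [LyonsPeres2016];
K. S. Alexander, Comm. Math. Phys. 168 (1995) 39–55 [AlexanderSimultaneousUniqueness1995]; O. Häggström, Y. Peres, Probab. Theory Related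
Fields 113 (1999) 273–285 [HaggstromPeres1999]; J. T. Chayes, L. Chayes, C. M. Newman, Comm. Math. Phys. 101 (1985) 383–407, Thm 3.2
[ChayesChayesNewman1985].
-/

noncomputable section

namespace Summit.CriticalPhenomena.PercolationContinuityZ3.Theorems.Rsw3

open Finset Filter MeasureTheory Literature.Probability.LatticeModels Literature.Probability.Percolation
open Literature.Probability.Percolation.Invasion

/-! ## §1 Deterministic core (every locally finite graph, every label field) -/

section General

variable {V : Type*} [DecidableEq V] {G : SimpleGraph V} [G.LocallyFinite]

omit [DecidableEq V] [G.LocallyFinite] in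
/-- The coupled clusters are monotone in the level: `p₁ ≤ p₂ ⇒ C_{p₁}(x) ⊆ C_{p₂}(x)`. [cite: LyonsPeres2016, §7.5 (the standard coupling)] -/
theorem openCluster_configOfLabels_mono {p₁ p₂ : ℝ} (h : p₁ ≤ p₂) (U : Sym2 V → ℝ) (x : V) :
    openCluster (configOfLabels p₁ U G) x ⊆ openCluster (configOfLabels p₂ U G) x :=
  openCluster_mono (configOfLabels_mono U G h) x

omit [DecidableEq V] [G.LocallyFinite] in
/-- Open paths persist when the level is raised. [cite: LyonsPeres2016, §7.5 (the standard coupling)] -/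
theorem reachable_configOfLabels_mono {p₁ p₂ : ℝ} (h : p₁ ≤ p₂) (U : Sym2 V → ℝ) {x y : V}
    (hxy : (openGraph (configOfLabels p₁ U G)).Reachable x y) : (openGraph (configOfLabels p₂ U G)).Reachable x y :=
  hxy.mono (openGraph_mono (configOfLabels_mono U G h))

omit [DecidableEq V] [G.LocallyFinite] in
/-- Percolation persists when the level is raised. [cite: LyonsPeres2016, §7.5 (the standard coupling)] -/
theorem percolatesAt_configOfLabels_mono {p₁ p₂ : ℝ} (h : p₁ ≤ p₂) (U : Sym2 V → ℝ) {x : V}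
    (hx : configOfLabels p₁ U G ∈ percolatesAt x) : configOfLabels p₂ U G ∈ percolatesAt x :=
  percolatesAt_mono (configOfLabels_mono U G h) x hx

/-- **"If `x` belongs to an infinite cluster `η` of `ω_p` then `I(x) ⊆ η` (this is clear)"** — every stage of the invasion from `x` stays
inside the infinite `p`-cluster of `x` (CCN's absorption principle at every step, then propagation through `p`-open bonds).
[cite: LyonsPeres2016, §7.5 p. 360 (before Thm. 7.22)] [cite: ChayesChayesNewman1985, §3 proof of Thm 3.2] -/
theorem invasion_subset_openCluster_of_infinite {U : Sym2 V → ℝ} {o : V} {p : ℝ}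
    (hinf : (openCluster (configOfLabels p U G) o).Infinite) (n : ℕ) :
    ↑(invasion G U o n) ⊆ openCluster (configOfLabels p U G) o := by
  intro v hv
  have hall : ∀ m, 0 ≤ m → acceptedLabel G U o m ≤ p := fun m _ =>
    acceptedLabel_le_of_infinite_cluster (root_mem_invasion U o m) hinf
  obtain ⟨u, hu, huv⟩ := Set.mem_iUnion₂.1
    (invadedRegion_subset_of_forall_acceptedLabel_le hall ((mem_invadedRegion G).2 ⟨n, Finset.mem_coe.1 hv⟩))
  have hu' : u = o := by simpa [invasion_zero] using hu
  subst hu'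
  exact huv

/-- Set form: `C_p(x)` infinite ⇒ `I(x) ⊆ C_p(x)`. [cite: LyonsPeres2016, §7.5 p. 360 (before Thm. 7.22)] -/
theorem invadedRegion_subset_openCluster_of_infinite {U : Sym2 V → ℝ} {o : V} {p : ℝ}
    (hinf : (openCluster (configOfLabels p U G) o).Infinite) :
    invadedRegion G U o ⊆ openCluster (configOfLabels p U G) o := by
  intro v hv
  obtain ⟨n, hn⟩ := (mem_invadedRegion G).1 hv
  exact invasion_subset_openCluster_of_infinite hinf n (Finset.mem_coe.2 hn)

/-- **If every label accepted from time `N` on is `≤ p`, some vertex invaded by time `N` lies in an infinite `p`-cluster** (infinite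
preconnected graph: the invaded region is infinite and lies in the union of the `p`-clusters of the finitely many vertices of `I_N`).
[cite: LyonsPeres2016, §7.5 p. 360 (before Thm. 7.22: "|I(x) ∩ η| = ∞ for some infinite cluster η")] [cite: ChayesChayesNewman1985, §3 (ii)] -/
theorem exists_infinite_openCluster_of_forall_acceptedLabel_le [Infinite V] (hG : G.Preconnected) {U : Sym2 V → ℝ} {o : V}
    {N : ℕ} {p : ℝ} (h : ∀ n, N ≤ n → acceptedLabel G U o n ≤ p) :
    ∃ u ∈ invasion G U o N, (openCluster (configOfLabels p U G) u).Infinite := by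
  by_contra hcon
  refine invadedRegion_infinite hG U o (invadedRegion_finite_of_forall_acceptedLabel_le h fun u hu => ?_)
  exact Set.not_infinite.1 fun hinf => hcon ⟨u, hu, hinf⟩

/-- **The deterministic core of Lyons–Peres' proof of Thm. 7.21** (book p. 364): for `p₁ ≤ p₂`, if `C_{p₂}(x)` is infinite and the
invasion from `x` accepts only labels `≤ p₁` from some time on, then `C_{p₂}(x)` contains an infinite `p₁`-cluster (through a vertex of
`I(x) ⊆ C_{p₂}(x)`). [cite: LyonsPeres2016, Thm. 7.21 (proof, p. 364)] -/
theorem exists_infinite_subcluster_of_forall_acceptedLabel_le [Infinite V] (hG : G.Preconnected) {U : Sym2 V → ℝ} {x : V}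
    {N : ℕ} {p₁ p₂ : ℝ} (hp : p₁ ≤ p₂) (hinf : (openCluster (configOfLabels p₂ U G) x).Infinite)
    (h : ∀ n, N ≤ n → acceptedLabel G U x n ≤ p₁) :
    ∃ u ∈ openCluster (configOfLabels p₂ U G) x, (openCluster (configOfLabels p₁ U G) u).Infinite ∧
      openCluster (configOfLabels p₁ U G) u ⊆ openCluster (configOfLabels p₂ U G) x := by
  obtain ⟨u, huN, hu⟩ := exists_infinite_openCluster_of_forall_acceptedLabel_le hG h
  have hux : u ∈ openCluster (configOfLabels p₂ U G) x :=
    invasion_subset_openCluster_of_infinite hinf N (Finset.mem_coe.2 huN)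
  refine ⟨u, hux, hu, fun v hv => ?_⟩
  show (openGraph (configOfLabels p₂ U G)).Reachable x v
  exact SimpleGraph.Reachable.trans hux (reachable_configOfLabels_mono hp U hv)

end General

/-! ## §2 `ℤ^d`: the acceptance profile from EVERY root, and Lyons–Peres Thm. 7.22 in simultaneous form -/

variable {d : ℕ}

/-- Transport to an arbitrary root: for labels injective on `Sym2 ℤ^d`, the invasion from `x` accepts the same labels as the invasion from
`0` of the pulled-back field `U ∘ Sym2.map (· + x)` (gen 29 file XXXVII, equivariance under the translation `· + x`).
[cite: LyonsPeres2016, §7.5 (invasion basins)] -/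
theorem acceptedLabel_root_eq_shift (x : Site d) {U : Sym2 (Site d) → ℝ} (hU : Function.Injective U) (n : ℕ) :
    acceptedLabel (zdGraph d) U x n = acceptedLabel (zdGraph d) (U ∘ Sym2.map (Site.shift x)) 0 n := by
  let φ : zdGraph d ≃g zdGraph d := { toEquiv := Site.shift x, map_rel_iff' := fun {a b} => zdGraph_adj_shift_iff x a b }
  have hφ0 : φ 0 = x := by show Site.shift x 0 = x; rw [Site.shift_apply, zero_add]
  have hUU' : ∀ u v, U s(φ u, φ v) = (U ∘ Sym2.map (Site.shift x)) s(u, v) := fun u v => by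
    simp only [Function.comp_apply, Sym2.map_mk]; rfl
  have hinj : Set.InjOn (U ∘ Sym2.map (Site.shift x)) (zdGraph d).edgeSet :=
    (hU.comp (Sym2.map.injective (Site.shift x).injective)).injOn
  have e := acceptedLabel_iso φ hUU' hinj 0 n
  rw [hφ0] at e
  exact e

/-- **A.s., for EVERY root `x ∈ ℤ^d` and EVERY level `y > p_c(ℤ^d)` at once, the invasion from `x` accepts only labels `≤ y` eventually**
(`d ≥ 2`; Chayes–Chayes–Newman Thm 3.2 = Lyons–Peres Thm 7.22 for `ℤ^d`, transported from the origin by translation invariance of `μ`).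
[cite: ChayesChayesNewman1985, Thm 3.2] [cite: LyonsPeres2016, Thm. 7.22] -/
theorem ae_forall_root_eventually_acceptedLabel_le (hd : 2 ≤ d) :
    ∀ᵐ U ∂(labelMeasure (Site d)), ∀ x : Site d, ∀ y : unitInterval, criticalProb (zdGraph d) (0 : Site d) < y →
      ∀ᶠ n in atTop, acceptedLabel (zdGraph d) U x n ≤ y := by
  have hall : ∀ x : Site d, ∀ᵐ U ∂(labelMeasure (Site d)), ∀ y : unitInterval, criticalProb (zdGraph d) (0 : Site d) < y →
      ∀ᶠ n in atTop, acceptedLabel (zdGraph d) U x n ≤ y := by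
    intro x
    filter_upwards [Literature.Barriers.CriticalPhenomena.ae_injective_labelMeasure (V := Site d),
      ae_comp_shift (ae_acceptedLabel_selfOrganised hd) x] with U hU hso
    intro y hy
    simp only [acceptedLabel_root_eq_shift x hU]
    exact hso.1 y hy
  exact ae_all_iff.2 hall

/-- Real-level form: a.s., for every root `x` and every real `p > p_c(ℤ^d)`, `x_n(x) ≤ p` for all large `n` (`d ≥ 2`; through the level
`min p 1 ∈ (p_c, 1]`, using `p_c(ℤ^d) < 1`). [cite: ChayesChayesNewman1985, Thm 3.2] [cite: LyonsPeres2016, Thm. 7.22] -/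
theorem ae_forall_root_eventually_acceptedLabel_le_real (hd : 2 ≤ d) :
    ∀ᵐ U ∂(labelMeasure (Site d)), ∀ x : Site d, ∀ p : ℝ, criticalProb (zdGraph d) (0 : Site d) < p →
      ∀ᶠ n in atTop, acceptedLabel (zdGraph d) U x n ≤ p := by
  filter_upwards [ae_forall_root_eventually_acceptedLabel_le hd] with U hU
  intro x p hp
  have h0 : (0 : ℝ) ≤ criticalProb (zdGraph d) (0 : Site d) := (criticalProb_mem_Icc _ _).1
  have h1 : criticalProb (zdGraph d) (0 : Site d) < 1 := criticalProb_zd_lt_one hd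
  let y : unitInterval := ⟨min p 1, ⟨le_min (h0.trans hp.le) zero_le_one, min_le_right _ _⟩⟩
  have hy : criticalProb (zdGraph d) (0 : Site d) < y := lt_min hp h1
  exact (hU x y hy).mono fun n hn => hn.trans (min_le_left _ _)

/-- **Lyons–Peres Thm. 7.22 (Invasion of Infinite Clusters; Häggström–Peres–Schonmann 1999, Chayes–Chayes–Newman 1985 for `ℤ^d`) in
SIMULTANEOUS form on `ℤ^d`, `d ≥ 2`**: almost surely, for all `p > p_c(ℤ^d)` and all `x ∈ ℤ^d`, some infinite `p`-cluster intersects the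
invasion basin `I(x)`. [cite: LyonsPeres2016, Thm. 7.22] [cite: ChayesChayesNewman1985, Thm 3.2] -/
theorem ae_forall_invadedRegion_meets_infinite_cluster (hd : 2 ≤ d) :
    ∀ᵐ U ∂(labelMeasure (Site d)), ∀ p : ℝ, criticalProb (zdGraph d) (0 : Site d) < p → ∀ x : Site d,
      ∃ u ∈ invadedRegion (zdGraph d) U x, (openCluster (configOfLabels p U (zdGraph d)) u).Infinite := by
  haveI : Nonempty (Fin d) := ⟨⟨0, by omega⟩⟩
  haveI : Infinite (Site d) := Pi.infinite_of_right
  filter_upwards [ae_forall_root_eventually_acceptedLabel_le_real hd] with U hU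
  intro p hp x
  obtain ⟨N, hN⟩ := eventually_atTop.1 (hU x p hp)
  obtain ⟨u, huN, hu⟩ := exists_infinite_openCluster_of_forall_acceptedLabel_le zdGraph_preconnected_holds hN
  exact ⟨u, (mem_invadedRegion (zdGraph d)).2 ⟨N, huN⟩, hu⟩

/-! ## §3 MERGING (Lyons–Peres Thm. 7.21 ¶2 on `ℤ^d`) -/

/-- **MERGING OF INFINITE CLUSTERS ON `ℤ^d` (Lyons–Peres Thm. 7.21 ¶2; Alexander 1995; Häggström–Peres–Schonmann 1999), `d ≥ 2`**: almost
surely, SIMULTANEOUSLY for all levels `p_c(ℤ^d) < p₁ ≤ p₂` and all `x ∈ ℤ^d`, if the `p₂`-cluster of `x` is infinite then it contains an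
infinite `p₁`-cluster: there is `u ∈ C_{p₂}(x)` with `C_{p₁}(u)` infinite (and `C_{p₁}(u) ⊆ C_{p₂}(x)`).  Proof as in the book (p. 364): on the
a.s. event of §2, `I(x) ⊆ C_{p₂}(x)` and the invasion from `x` eventually accepts only labels `≤ p₁`.
[cite: LyonsPeres2016, Thm. 7.21 (and proof p. 364)] -/
theorem ae_merging (hd : 2 ≤ d) :
    ∀ᵐ U ∂(labelMeasure (Site d)), ∀ p₁ p₂ : ℝ, criticalProb (zdGraph d) (0 : Site d) < p₁ → p₁ ≤ p₂ → ∀ x : Site d,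
      (openCluster (configOfLabels p₂ U (zdGraph d)) x).Infinite →
        ∃ u ∈ openCluster (configOfLabels p₂ U (zdGraph d)) x, (openCluster (configOfLabels p₁ U (zdGraph d)) u).Infinite ∧
          openCluster (configOfLabels p₁ U (zdGraph d)) u ⊆ openCluster (configOfLabels p₂ U (zdGraph d)) x := by
  haveI : Nonempty (Fin d) := ⟨⟨0, by omega⟩⟩
  haveI : Infinite (Site d) := Pi.infinite_of_right
  filter_upwards [ae_forall_root_eventually_acceptedLabel_le_real hd] with U hU
  intro p₁ p₂ hp₁ hp x hinf
  obtain ⟨N, hN⟩ := eventually_atTop.1 (hU x p₁ hp₁)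
  exact exists_infinite_subcluster_of_forall_acceptedLabel_le zdGraph_preconnected_holds hp hinf hN

/-- The same in the vocabulary of the events `{|C(x)| = ∞}`: a.s., for all `p_c < p₁ ≤ p₂` and all `x`, `η_{p₂} ∈ {|C(x)| = ∞}` ⇒ some `u`
joined to `x` by a `p₂`-open path has `η_{p₁} ∈ {|C(u)| = ∞}`. [cite: LyonsPeres2016, Thm. 7.21] -/
theorem ae_merging_percolatesAt (hd : 2 ≤ d) :
    ∀ᵐ U ∂(labelMeasure (Site d)), ∀ p₁ p₂ : ℝ, criticalProb (zdGraph d) (0 : Site d) < p₁ → p₁ ≤ p₂ → ∀ x : Site d,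
      configOfLabels p₂ U (zdGraph d) ∈ percolatesAt x →
        ∃ u, (openGraph (configOfLabels p₂ U (zdGraph d))).Reachable x u ∧ configOfLabels p₁ U (zdGraph d) ∈ percolatesAt u := by
  filter_upwards [ae_merging hd] with U hU
  intro p₁ p₂ hp₁ hp x hx
  obtain ⟨u, hux, hu, -⟩ := hU p₁ p₂ hp₁ hp x hx
  exact ⟨u, hux, hu⟩

/-- `ℤ³`: a.s., simultaneously for all `p_c(ℤ³) < p₁ ≤ p₂` and all `x`, every infinite `p₂`-cluster `C_{p₂}(x)` contains an infinite
`p₁`-cluster. [cite: LyonsPeres2016, Thm. 7.21] -/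
theorem ae_merging_Z3 :
    ∀ᵐ U ∂(labelMeasure (Site 3)), ∀ p₁ p₂ : ℝ, criticalProb (zdGraph 3) (0 : Site 3) < p₁ → p₁ ≤ p₂ → ∀ x : Site 3,
      (openCluster (configOfLabels p₂ U (zdGraph 3)) x).Infinite →
        ∃ u ∈ openCluster (configOfLabels p₂ U (zdGraph 3)) x, (openCluster (configOfLabels p₁ U (zdGraph 3)) u).Infinite :=
  by
  filter_upwards [ae_merging (d := 3) (by norm_num)] with U hU
  intro p₁ p₂ hp₁ hp x hx
  obtain ⟨u, hux, hu, -⟩ := hU p₁ p₂ hp₁ hp x hx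
  exact ⟨u, hux, hu⟩

end Summit.CriticalPhenomena.PercolationContinuityZ3.Theorems.Rsw3
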